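import Summits.QuantumFields.YangMills.Theorems.LuscherReductionDressedRitzOfDiagonalPlateau
import HarnessLib

/-!
# Route `LuscherReduction`, item `DressedRitz` (stmt-QuantumFields-20205) — reduction chain, file 3:
# the vacuum generator is EXACT — `ExcitedPlateauAt k → DiagonalPlateauAt k → DressedRitzAt k`, and the route decl from `∀ k, ExcitedPlateauAt k`

Support module of the `FemtoTransferGap` group (fleet service by seat ym-infvol-p2 g6; route `LuscherReduction`, femto rung R2b1; bears on the
crux child `DressedRitz` = stmt-QuantumFields-20205 of RED stmt-QuantumFields-19978; owner ym-beyond-p1 g19 ask (β) «DressedRitz via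
`KTGen.dressedRitz_of_excitedPlateau`, rfl transport to the route decl» — THIS FILE is that transport, importable).  CONTENT = §9 of the planner's
crux workfile `Summits/QuantumFields/YangMills/Cruxes/RunningReduction/Lines/DressedRitzGEVP.lean` (rev 3, sha16 8eae6de8b30412fb, seat
ym-cruxidea-19978-1 GEN 5; kernel-checked there) RE-HOMED on the Theorems side LEVEL BY LEVEL (cuts ↦ their `k`-slices of
`…DressedRitzPlateauDefs.lean`, proofs VERBATIM minus the leading `intro k`).

In `DiagonalPlateauAt k` the vacuum generator `v₀` may be taken to be an EXACT physical unit ground state `Ω` of `K_β` (`K_βΩ = λ₀Ω`; in the tree by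
`PhysL2.exists_isPhys_eigenfamily` at level `0`, `λ₀ > 0` by `levelValue_zero_su2Rep_pos`) — and then (p6) top capture, the `j = 0` instances of
(p2)/(p3)/(p5) and the `(0,l)` instances of (p0)/(p4) are AUTOMATIC (`qform(Ω,w) = λ₀⟨Ω,w⟩`, so the symmetrised vacuum coupling is
`((λ₀−d_l)/2)·⟨Ω,w_l⟩ = O(λ/L)·O(λ)·λ₀`).  What remains is `ExcitedPlateauAt k`: data (x1)–(x7) on `k` EXCITED generators only.

* `vacuumCoupling_aux` — real bookkeeping `|λ₀X − ((λ₀+d)/2)X| ≤ C'²(s²/r)λ₀`.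
* ★★ `diagonalPlateauAt_of_excitedPlateauAt : ExcitedPlateauAt k → DiagonalPlateauAt k` (witness family `Fin.cons Ω w`, output constant `(max C 1)²`).
* `ritzGeneratorsAt_of_excitedPlateauAt`, ★ `dressedRitzAt_of_excitedPlateauAt : ExcitedPlateauAt k → DressedRitzAt k`.
* ★★ `dressedRitz_of_excitedPlateau : (∀ k, ExcitedPlateauAt k) → Theses.LuscherReduction.DressedRitz` — closing item 20205 = proving
  `ExcitedPlateauAt k` for every `k` (or `OperatorPlateauAt k`, file 4) and applying this theorem.

HONEST FRAMING: fixed-lattice Rayleigh–Ritz bookkeeping on the femto rung R2b1; proves nothing OF `DressedRitz` ∕ `ExcitedPlateauAt` (the XL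
renormalisation-group estimate of excited-channel correlators in the femto window); no bearing on infinite volume, the continuum limit or the Clay
mass gap.  References: M. Lüscher, NPB 219 (1983) 233 [cite: Luscher1983, §3]; Reed–Simon IV, Thm. XIII.1 [cite: ReedSimonIV1978, Thm. XIII.1];
Lüscher–Wolff (GEVP) [cite: LuscherWolff1990].
-/

set_option autoImplicit false

noncomputable section

open MeasureTheory Filter Topology Real
open Literature.MathematicalPhysics.QuantumFieldTheory
open Literature.MathematicalPhysics.QuantumLattice
open Literature.Analysis.OperatorTheory.YMMatrixModel
open Literature.Analysis.OperatorTheory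
open scoped BigOperators

namespace Summit.QuantumFields.YangMills.Theorems.FemtoTransferGap.KTGen

open Summit.QuantumFields.YangMills.Theorems.FemtoTransferGap
open Summit.QuantumFields.YangMills.Theorems.FemtoTransferGap.KTRCalibration
open Summit.QuantumFields.YangMills.Theorems.FemtoTransferGap.PhysL2

/-! ## §9 The vacuum generator is EXACT: `ExcitedPlateauAt k → DiagonalPlateauAt k` -/

/-- Real bookkeeping for the vacuum–excited coupling: `|λ₀X − ((λ₀+d)/2)X| = ((λ₀−d)/2)|X| ≤ C'²(s²/r)λ₀` from `|X| ≤ C's`,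
`0 ≤ λ₀ − d ≤ C'(s/r)λ₀`. [folklore] -/
theorem vacuumCoupling_aux {l0 d X C' s r : ℝ} (hC' : 0 ≤ C') (hs : 0 ≤ s) (hsr : 0 ≤ s / r) (hl0 : 0 ≤ l0)
    (hX : |X| ≤ C' * s) (hd0 : d ≤ l0) (hd : l0 - d ≤ C' * (s / r) * l0) :
    |l0 * X - (l0 + d) / 2 * X| ≤ C' ^ 2 * (s ^ 2 / r) * l0 := by
  have h1 : l0 * X - (l0 + d) / 2 * X = (l0 - d) / 2 * X := by ring
  rw [h1, abs_mul, abs_of_nonneg (by linarith : 0 ≤ (l0 - d) / 2)]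
  have hA : 0 ≤ C' * (s / r) * l0 := mul_nonneg (mul_nonneg hC' hsr) hl0
  have h2 : (l0 - d) / 2 * |X| ≤ C' * (s / r) * l0 / 2 * (C' * s) :=
    mul_le_mul (by linarith) hX (abs_nonneg X) (by linarith)
  have h3 : 0 ≤ C' ^ 2 * (s ^ 2 / r) * l0 := by
    have : C' ^ 2 * (s ^ 2 / r) * l0 = (C' * (s / r) * l0) * (C' * s) := by ring
    rw [this]
    exact mul_nonneg hA (mul_nonneg hC' hs)
  calc (l0 - d) / 2 * |X| ≤ C' * (s / r) * l0 / 2 * (C' * s) := h2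
    _ = C' ^ 2 * (s ^ 2 / r) * l0 / 2 := by ring
    _ ≤ C' ^ 2 * (s ^ 2 / r) * l0 := by linarith

set_option maxHeartbeats 800000 in
/-- ★★ **`ExcitedPlateauAt k → DiagonalPlateauAt k`: the vacuum generator of the GEVP-free cut may be taken EXACT.**  Witness family
`v := Fin.cons Ω w` with `Ω` the physical unit top eigenvector of (x3); output constant `(max C 1)²`, same `lam0`.  (p6) is the top Rayleigh bound
`qform ≤ λ₀‖·‖²` (`qform_le_levelValue_zero_mul`), the vacuum residual is `0`, the vacuum Lüscher position is `λ₀μ₀ ≤ e^{(·)≥0}μ₀λ₀`, the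
vacuum couplings are `vacuumCoupling_aux` from (x3) ∧ (x7), and (p0) at `(0,l)` is `d_l ≤ λ₀`. [cite: ReedSimonIV1978, Thm. XIII.1] -/
theorem diagonalPlateauAt_of_excitedPlateauAt {k : ℕ} (h : ExcitedPlateauAt k) : DiagonalPlateauAt k := by
  intro η hη
  obtain ⟨C, lam0, hlam0, hC⟩ := h
  set C' : ℝ := max C 1 with hC'def
  have hC'1 : 1 ≤ C' := le_max_right C 1
  have hC'0 : 0 ≤ C' := zero_le_one.trans hC'1
  have hCC' : C ≤ C' := le_max_left C 1
  have hC'R : C' ≤ C' ^ 2 := by nlinarith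
  have hCR : C ≤ C' ^ 2 := hCC'.trans hC'R
  have hR0 : 0 ≤ C' ^ 2 := sq_nonneg _
  refine ⟨C' ^ 2, lam0, hlam0, fun lam hlam hle => ?_⟩
  obtain ⟨L0, hL⟩ := hC lam hlam hle
  refine ⟨L0, fun L _ hL0 β hW => ?_⟩
  obtain ⟨w, hw, hunit, hanti, horth, ⟨Ω, hΩ, hΩ1, hKΩ, hvac⟩, hres, hlus, hcoup, hspr⟩ := hL L hL0 β hW
  have hβ : (0 : ℝ) ≤ β := zero_le_one.trans hW.1
  have hB : 0 ≤ oneSiteCoupling β L := oneSiteCoupling_nonneg β L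
  have hlam_nn : 0 ≤ luscherLambda β L := luscherLambda_nonneg β L
  have hLnn : (0 : ℝ) ≤ (L : ℝ) := Nat.cast_nonneg L
  have ht1 : 0 ≤ luscherLambda β L / L := div_nonneg hlam_nn hLnn
  have ht2 : 0 ≤ luscherLambda β L ^ 2 / L := div_nonneg (sq_nonneg _) hLnn
  have ht3 : 0 ≤ luscherLambda β L ^ 3 / (L : ℝ) ^ 2 := div_nonneg (pow_nonneg hlam_nn 3) (sq_nonneg _)
  have hlv0 : 0 ≤ levelValue su2Rep L β 0 := (levelValue_zero_su2Rep_pos L β).le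
  -- the exact vacuum generator `Ω` delivered by (x3): `‖Ω‖ = 1`, `K_βΩ = λ₀Ω`, hence `qform(Ω,Ω) = λ₀`
  have hqΩ : qform su2Rep β Ω Ω = levelValue su2Rep L β 0 := by
    rw [qform_eq_l2_transferApply, hKΩ, l2_comm Ω, l2_smul_left, hΩ1, mul_one]
  -- consequences of the excited data
  have hd_le : ∀ i, qform su2Rep β (w i) (w i) ≤ levelValue su2Rep L β 0 := fun i => by
    have h1 := qform_le_levelValue_zero_mul su2Rep continuous_su2Rep β (hw i) (by rw [hunit i]; exact one_pos)
    rw [hunit i, mul_one] at h1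
    exact h1
  have hvacΩ : ∀ i, |l2 Ω (w i)| ≤ C' * luscherLambda β L := fun i =>
    (hvac i).trans (mul_le_mul_of_nonneg_right hCC' hlam_nn)
  have hsprC : ∀ i, levelValue su2Rep L β 0 - qform su2Rep β (w i) (w i)
      ≤ C' * (luscherLambda β L / L) * levelValue su2Rep L β 0 := fun i =>
    (hspr i).trans (mul_le_mul_of_nonneg_right (mul_le_mul_of_nonneg_right hCC' ht1) hlv0)
  have hqΩw : ∀ i, qform su2Rep β Ω (w i) = levelValue su2Rep L β 0 * l2 Ω (w i) := fun i => by
    rw [qform_su2Rep_comm β hΩ (hw i), qform_eq_l2_transferApply, hKΩ, l2_comm (w i), l2_smul_left]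
  have hqwΩ : ∀ i, qform su2Rep β (w i) Ω = levelValue su2Rep L β 0 * l2 Ω (w i) := fun i => by
    rw [← qform_su2Rep_comm β hΩ (hw i)]
    exact hqΩw i
  have hbig1 : C' * luscherLambda β L ≤ C' ^ 2 * luscherLambda β L := mul_le_mul_of_nonneg_right hC'R hlam_nn
  refine ⟨(Fin.cons Ω w : Fin (k + 1) → GaugeConfig 3 L SU2 → ℝ), fun i => ?_, fun i => ?_, fun i l hil => ?_,
    fun i l hil => ?_, fun i => ?_, fun j => ?_, fun i l hil => ?_, ?_, fun ψ hψ => ?_⟩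
  · -- physical
    rcases Fin.eq_zero_or_eq_succ i with rfl | ⟨i, rfl⟩
    · simp only [Fin.cons_zero]; exact hΩ
    · simp only [Fin.cons_succ]; exact hw i
  · -- unit norm
    rcases Fin.eq_zero_or_eq_succ i with rfl | ⟨i, rfl⟩
    · simp only [Fin.cons_zero]; exact hΩ1
    · simp only [Fin.cons_succ]; exact hunit i
  · -- (p0) sorted diagonal values
    rcases Fin.eq_zero_or_eq_succ i with rfl | ⟨i, rfl⟩ <;> rcases Fin.eq_zero_or_eq_succ l with rfl | ⟨l, rfl⟩
    · exact le_rfl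
    · simp only [Fin.cons_zero, Fin.cons_succ]; rw [hqΩ]; exact hd_le l
    · exact absurd hil (not_le.mpr (Fin.succ_pos i))
    · simp only [Fin.cons_succ]; exact hanti i l (Fin.succ_le_succ_iff.mp hil)
  · -- (p1) near-orthogonality
    rcases Fin.eq_zero_or_eq_succ i with rfl | ⟨i, rfl⟩ <;> rcases Fin.eq_zero_or_eq_succ l with rfl | ⟨l, rfl⟩
    · exact absurd rfl hil
    · simp only [Fin.cons_zero, Fin.cons_succ]; exact (hvacΩ l).trans hbig1
    · simp only [Fin.cons_zero, Fin.cons_succ]; rw [l2_comm (w i)]; exact (hvacΩ i).trans hbig1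
    · simp only [Fin.cons_succ]
      exact (horth i l (fun h => hil (by rw [h]))).trans (mul_le_mul_of_nonneg_right hCR hlam_nn)
  · -- (p2) one-step residuals
    rcases Fin.eq_zero_or_eq_succ i with rfl | ⟨i, rfl⟩
    · simp only [Fin.cons_zero]
      have hz : transferApply β Ω - qform su2Rep β Ω Ω • Ω = 0 := by rw [hKΩ, hqΩ, sub_self]
      rw [hz, l2_zero_zero]
      exact mul_nonneg (mul_nonneg hR0 ht3) (sq_nonneg _)
    · simp only [Fin.cons_zero, Fin.cons_succ]
      rw [hqΩ]
      exact (hres i).trans (mul_le_mul_of_nonneg_right (mul_le_mul_of_nonneg_right hCR ht3) (sq_nonneg _))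
  · -- (p3) Lüscher position
    rcases Fin.eq_zero_or_eq_succ j with rfl | ⟨j, rfl⟩
    · simp only [Fin.cons_zero, Fin.val_zero]
      rw [hqΩ]
      have hexp : 1 ≤ Real.exp (C' ^ 2 * luscherLambda β L ^ 2 / L) :=
        Real.one_le_exp (div_nonneg (mul_nonneg hR0 (sq_nonneg _)) hLnn)
      have hY : 0 ≤ levelValue su2Rep 1 (oneSiteCoupling β L) 0 * levelValue su2Rep L β 0 :=
        mul_nonneg (levelValue_su2Rep_nonneg 1 hB 0) hlv0
      constructor
      · calc levelValue su2Rep L β 0 * levelValue su2Rep 1 (oneSiteCoupling β L) 0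
            = 1 * (levelValue su2Rep 1 (oneSiteCoupling β L) 0 * levelValue su2Rep L β 0) := by ring
          _ ≤ Real.exp (C' ^ 2 * luscherLambda β L ^ 2 / L) *
              (levelValue su2Rep 1 (oneSiteCoupling β L) 0 * levelValue su2Rep L β 0) := mul_le_mul_of_nonneg_right hexp hY
      · calc levelValue su2Rep 1 (oneSiteCoupling β L) 0 * levelValue su2Rep L β 0
            = 1 * (levelValue su2Rep L β 0 * levelValue su2Rep 1 (oneSiteCoupling β L) 0) := by ring
          _ ≤ Real.exp (C' ^ 2 * luscherLambda β L ^ 2 / L) *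
              (levelValue su2Rep L β 0 * levelValue su2Rep 1 (oneSiteCoupling β L) 0) :=
            mul_le_mul_of_nonneg_right hexp (by rw [mul_comm]; exact hY)
    · simp only [Fin.cons_zero, Fin.cons_succ, Fin.val_succ]
      rw [hqΩ]
      obtain ⟨ha, hb⟩ := hlus j
      exact ⟨le_exp_mul_div_of_le ha ht2 (mul_nonneg (levelValue_su2Rep_nonneg 1 hB _) hlv0) hCR,
        le_exp_mul_div_of_le hb ht2 (mul_nonneg (qform_su2Rep_self_nonneg hβ (hw j)) (levelValue_su2Rep_nonneg 1 hB 0)) hCR⟩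
  · -- (p4) symmetrised couplings
    rcases Fin.eq_zero_or_eq_succ i with rfl | ⟨i, rfl⟩ <;> rcases Fin.eq_zero_or_eq_succ l with rfl | ⟨l, rfl⟩
    · exact absurd rfl hil
    · simp only [Fin.cons_zero, Fin.cons_succ]
      rw [hqΩ, hqΩw l]
      exact vacuumCoupling_aux hC'0 hlam_nn ht1 hlv0 (hvacΩ l) (hd_le l) (hsprC l)
    · simp only [Fin.cons_zero, Fin.cons_succ]
      rw [hqΩ, hqwΩ i, l2_comm (w i), add_comm (qform su2Rep β (w i) (w i))]
      exact vacuumCoupling_aux hC'0 hlam_nn ht1 hlv0 (hvacΩ i) (hd_le i) (hsprC i)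
    · simp only [Fin.cons_zero, Fin.cons_succ]
      rw [hqΩ]
      exact (hcoup i l (fun h => hil (by rw [h]))).trans
        (mul_le_mul_of_nonneg_right (mul_le_mul_of_nonneg_right hCR ht2) hlv0)
  · -- (p5) spread
    rcases Fin.eq_zero_or_eq_succ (Fin.last k) with h0 | ⟨j, hj⟩
    · rw [h0]
      simp only [Fin.cons_zero]
      rw [hqΩ, sub_self]
      exact mul_nonneg (mul_nonneg hR0 ht1) hlv0
    · rw [hj]
      simp only [Fin.cons_zero, Fin.cons_succ]
      rw [hqΩ]
      exact (hsprC j).trans (mul_le_mul_of_nonneg_right (mul_le_mul_of_nonneg_right hC'R ht1) hlv0)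
  · -- (p6) top capture for free
    simp only [Fin.cons_zero]
    rw [hqΩ]
    have hexp : 1 ≤ Real.exp (η * luscherLambda β L / L) :=
      Real.one_le_exp (div_nonneg (mul_nonneg hη.le hlam_nn) hLnn)
    have hl2 : 0 ≤ l2 ψ ψ := l2_self_nonneg ψ
    rcases hl2.eq_or_lt with h0 | hpos
    · rw [← h0, mul_zero, qform_eq_zero_of_l2_eq_zero β hψ h0.symm]
    · calc qform su2Rep β ψ ψ ≤ levelValue su2Rep L β 0 * l2 ψ ψ :=
            qform_le_levelValue_zero_mul su2Rep continuous_su2Rep β hψ hpos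
        _ = 1 * levelValue su2Rep L β 0 * l2 ψ ψ := by rw [one_mul]
        _ ≤ Real.exp (η * luscherLambda β L / L) * levelValue su2Rep L β 0 * l2 ψ ψ :=
            mul_le_mul_of_nonneg_right (mul_le_mul_of_nonneg_right hexp hlv0) hl2

/-- Corollary: `ExcitedPlateauAt k → RitzGeneratorsAt k`. [cite: Luscher1983, §3] -/
theorem ritzGeneratorsAt_of_excitedPlateauAt {k : ℕ} (h : ExcitedPlateauAt k) : RitzGeneratorsAt k :=
  ritzGeneratorsAt_of_diagonalPlateauAt (diagonalPlateauAt_of_excitedPlateauAt h)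

/-- ★ Corollary: **`ExcitedPlateauAt k → DressedRitzAt k`** (level-`k` slice of item 20205). [cite: Luscher1983, §3] -/
theorem dressedRitzAt_of_excitedPlateauAt {k : ℕ} (h : ExcitedPlateauAt k) : DressedRitzAt k :=
  dressedRitzAt_of_diagonalPlateauAt (diagonalPlateauAt_of_excitedPlateauAt h)

/-! ## §9b The route decl from the excited-sector cut at every level -/

/-- ★★ **`(∀ k, ExcitedPlateauAt k) → Theses.LuscherReduction.DressedRitz`** (item stmt-QuantumFields-20205, BY NAME; `= ∀ k, DressedRitzAt k`
definitionally): the owner's «rfl transport to the route decl» of `KTGen.dressedRitz_of_excitedPlateau`, importable. [cite: Luscher1983, §3] -/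
theorem dressedRitz_of_excitedPlateau (h : ∀ k : ℕ, ExcitedPlateauAt k) :
    Summit.QuantumFields.YangMills.Theses.LuscherReduction.DressedRitz :=
  fun k => dressedRitzAt_of_excitedPlateauAt (h k)

end Summit.QuantumFields.YangMills.Theorems.FemtoTransferGap.KTGen

end
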